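import Literature.NumberTheory.Automorphic.AlgebraicWeightStageLattices
import Mathlib.LinearAlgebra.FreeModule.PID
import HarnessLib

/-!
# The stage lattices are finite free `ℤ_p`-modules exhausting `V_λ(ℚ̄_p)` up to `p`-powers

Topic `NumberTheory/Automorphic`; namespace `Literature.NumberTheory.Automorphic.AlgebraicWeight`.
Theorems only; no definition, no named fact, no instance, no `sorry`.

Continuing `AlgebraicWeightStageLattices`: for a finite set `S` of integral scalars
(`‖c‖ ≤ 1` for `c ∈ S`),

* `stageLattice_subset_span` / `exists_finset_span_eq_stageLattice` / `stageLattice_fg` — `M_S` is a finitely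
  generated `ℤ_p`-module (an `𝒪_E[S]`-span of finitely many vectors, and `𝒪_E[S]` is a finitely
  generated `ℤ_p`-module, `ParallelWeight.exists_finset_span_eq_stageRing`); hence
  `moduleFinite_stageLattice`, `moduleFree_stageLattice` (torsion-free over the PID `ℤ_p`);
* `exists_pow_smul_mem_stageLattice` — **every `v ∈ V` has `p^t v ∈ M_S` for some finite set `S`
  of integral scalars and some `t`** (`V = ⋃_{S,t} p^{-t} M_S`), from `M_𝒪 ⊗ ℚ̄_p = V`
  (`span_coeffIntForm_eq_top`) and `‖p^t c‖ ≤ 1` for `t ≫ 0`;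
* `modTrivialOn_divLattice` — if `U_r` acts trivially on `M / p^s` then also on `p^{-t}M / p^s`.

These are the finiteness inputs "`M_{ξ,K}` is a finite free `ℤ_p`-module with
`M_{ξ,K} ⊗ ℚ̄_p = ξ`" of the proof of [Scholze2015, Thm. V.4.1], arranged over the directed
system of stage rings (the tree's `ℚ̄_p` is not complete, so no single `p`-adically complete
finite extension `E ⊂ ℚ̄_p` carries `M_{ξ,K}`; the stages replace it).

## References

* P. Scholze, *On torsion in the cohomology of locally symmetric varieties*, Ann. of Math. 182
  (2015), §V.4, proof of Thm. V.4.1. [Scholze2015]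
-/

noncomputable section

open IsDedekindDomain NumberField
open scoped Pointwise Classical

namespace Literature.NumberTheory.Automorphic

namespace AlgebraicWeight

variable (K : Type) [Field K] [NumberField K] (n p : ℕ) [Fact p.Prime]
  (lam : (K →+* PadicAlgCl p) → Fin n → ℤ)

/-! ### `M_S` is finitely generated over `ℤ_p` -/

omit [NumberField K] in
/-- For `o ∈ span_{ℤ_p} T` and `g ∈ G`, `o • g ∈ span_{ℤ_p} (T • G)`. [folklore] -/
theorem smul_mem_span_smul {T : Finset (PadicAlgCl p)}
    {G : Finset (ResGLnCohomology.CoeffModule (PadicAlgCl p) n K lam)} {o : PadicAlgCl p}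
    (ho : o ∈ Submodule.span ℤ_[p] (T : Set (PadicAlgCl p)))
    {g : ResGLnCohomology.CoeffModule (PadicAlgCl p) n K lam} (hg : g ∈ G) :
    o • g ∈ Submodule.span ℤ_[p]
      ((T • G : Finset (ResGLnCohomology.CoeffModule (PadicAlgCl p) n K lam)) :
        Set (ResGLnCohomology.CoeffModule (PadicAlgCl p) n K lam)) := by
  induction ho using Submodule.span_induction with
  | mem t ht =>
    exact Submodule.subset_span (Finset.mem_coe.2 (Finset.smul_mem_smul ht hg))
  | zero =>
    rw [zero_smul]
    exact Submodule.zero_mem _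
  | add o o' _ _ ho ho' =>
    rw [add_smul]
    exact Submodule.add_mem _ ho ho'
  | smul z o _ ho =>
    rw [smul_assoc]
    exact Submodule.smul_mem _ z ho

/-- **`M_S ⊆ span_{ℤ_p} (T • G)`** for `𝒪_E[S] ⊆ span_{ℤ_p} T` and `M_S = span_{𝒪_E[S]} G`.
[folklore] -/
theorem stageLattice_subset_span {S : Finset (PadicAlgCl p)} {T : Finset (PadicAlgCl p)}
    (hT : ∀ x ∈ ParallelWeight.stageRing K p S, x ∈ Submodule.span ℤ_[p] (T : Set (PadicAlgCl p)))
    {G : Finset (ResGLnCohomology.CoeffModule (PadicAlgCl p) n K lam)}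
    (hG : Submodule.span (ParallelWeight.stageRing K p S)
        (G : Set (ResGLnCohomology.CoeffModule (PadicAlgCl p) n K lam)) =
      ResGLnCohomology.coeffIntForm (PadicAlgCl p) (ParallelWeight.stageRing K p S) n K lam) :
    (stageLattice K n p lam S : Set (ResGLnCohomology.CoeffModule (PadicAlgCl p) n K lam)) ⊆
      Submodule.span ℤ_[p]
        ((T • G : Finset (ResGLnCohomology.CoeffModule (PadicAlgCl p) n K lam)) :
        Set (ResGLnCohomology.CoeffModule (PadicAlgCl p) n K lam)) := by
  intro x hx
  rw [SetLike.mem_coe, mem_stageLattice_iff, ← hG] at hx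
  -- strengthen: every `𝒪`-multiple of `x` lies in the `ℤ_p`-span
  suffices h : ∀ o : ParallelWeight.stageRing K p S, (o : PadicAlgCl p) • x ∈ Submodule.span ℤ_[p]
      ((T • G : Finset (ResGLnCohomology.CoeffModule (PadicAlgCl p) n K lam)) :
        Set (ResGLnCohomology.CoeffModule (PadicAlgCl p) n K lam)) by
    have h1 := h 1
    rwa [Subring.coe_one, one_smul] at h1
  induction hx using Submodule.span_induction with
  | mem g hg => exact fun o => smul_mem_span_smul K n p lam (hT o o.2) hg
  | zero => exact fun o => by rw [smul_zero]; exact Submodule.zero_mem _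
  | add y z _ _ hy hz => exact fun o => by rw [smul_add]; exact Submodule.add_mem _ (hy o) (hz o)
  | smul o' y _ hy =>
    intro o
    have h : (o : PadicAlgCl p) • (o' • y) = ((o * o' : ParallelWeight.stageRing K p S) :
        PadicAlgCl p) • y := by
      rw [Subring.coe_mul, mul_smul]
      rfl
    rw [h]
    exact hy (o * o')

omit [NumberField K] in
/-- `T • G ⊆ M` when `T ⊆ 𝒪` and `G ⊆ M` for an `𝒪`-submodule `M`. [folklore] -/
theorem smul_finset_subset {𝒪 : Subring (PadicAlgCl p)} {T : Finset (PadicAlgCl p)}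
    (hT : (T : Set (PadicAlgCl p)) ⊆ 𝒪)
    {M : Submodule 𝒪 (ResGLnCohomology.CoeffModule (PadicAlgCl p) n K lam)}
    {G : Finset (ResGLnCohomology.CoeffModule (PadicAlgCl p) n K lam)}
    (hG : (G : Set (ResGLnCohomology.CoeffModule (PadicAlgCl p) n K lam)) ⊆ M) :
    ((T • G : Finset (ResGLnCohomology.CoeffModule (PadicAlgCl p) n K lam)) :
        Set (ResGLnCohomology.CoeffModule (PadicAlgCl p) n K lam)) ⊆ M := by
  intro x hx
  rw [Finset.mem_coe, Finset.mem_smul] at hx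
  obtain ⟨t, ht, g, hg, rfl⟩ := hx
  have h : (t • g : ResGLnCohomology.CoeffModule (PadicAlgCl p) n K lam) =
      (⟨t, hT (Finset.mem_coe.2 ht)⟩ : 𝒪) • g := rfl
  rw [SetLike.mem_coe, h]
  exact M.smul_mem _ (hG (Finset.mem_coe.2 hg))

/-- **`M_S` is the `ℤ_p`-span of a finite set** (for `S` integral). [folklore] -/
theorem exists_finset_span_eq_stageLattice {S : Finset (PadicAlgCl p)} (hS : ∀ c ∈ S, ‖c‖ ≤ 1) :
    ∃ F : Finset (ResGLnCohomology.CoeffModule (PadicAlgCl p) n K lam),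
      Submodule.span ℤ_[p] (F : Set (ResGLnCohomology.CoeffModule (PadicAlgCl p) n K lam)) =
        stageLattice K n p lam S := by
  obtain ⟨T, hT𝒪, hT⟩ := ParallelWeight.exists_finset_span_eq_stageRing K p hS
  obtain ⟨G, hG⟩ := ResGLnCohomology.coeffIntForm_fg (PadicAlgCl p) (ParallelWeight.stageRing K p S)
    n K lam
  refine ⟨(T • G), le_antisymm ?_ (stageLattice_subset_span K n p lam hT hG)⟩
  rw [Submodule.span_le]
  refine smul_finset_subset K n p lam hT𝒪 (M := ResGLnCohomology.coeffIntForm (PadicAlgCl p)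
    (ParallelWeight.stageRing K p S) n K lam) ?_
  rw [← hG]
  exact Submodule.subset_span

/-- **`M_S` is a finitely generated `ℤ_p`-module** (for `S` integral).
[cite: Scholze2015, §V.4 (M_{ξ,K} finite free over ℤ_p)] -/
theorem stageLattice_fg {S : Finset (PadicAlgCl p)} (hS : ∀ c ∈ S, ‖c‖ ≤ 1) :
    (stageLattice K n p lam S).FG := by
  obtain ⟨F, hF⟩ := exists_finset_span_eq_stageLattice K n p lam hS
  exact ⟨F, hF⟩

/-- `M_S` is module-finite over `ℤ_p`. [folklore] -/
theorem moduleFinite_stageLattice {S : Finset (PadicAlgCl p)} (hS : ∀ c ∈ S, ‖c‖ ≤ 1) :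
    Module.Finite ℤ_[p] (stageLattice K n p lam S) :=
  Module.Finite.iff_fg.2 (stageLattice_fg K n p lam hS)

/-- **`M_S` is a free `ℤ_p`-module** (finitely generated and torsion-free over the PID `ℤ_p`).
[cite: Scholze2015, §V.4 (M_{ξ,K} finite free over ℤ_p)] -/
theorem moduleFree_stageLattice {S : Finset (PadicAlgCl p)} (hS : ∀ c ∈ S, ‖c‖ ≤ 1) :
    Module.Free ℤ_[p] (stageLattice K n p lam S) := by
  haveI := moduleFinite_stageLattice K n p lam hS
  exact Module.free_of_finite_type_torsion_free'

/-! ### `V = ⋃_{S,t} p^{-t} M_S` -/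

/-- **Every vector becomes integral over some stage after multiplication by a power of `p`**:
`∃ S` (finite, integral) `∃ t`, `p^t v ∈ M_S`. [cite: Scholze2015, §V.4 (M_ξ ⊗ ℚ̄_p = ξ)] -/
theorem exists_pow_smul_mem_stageLattice (v : ResGLnCohomology.CoeffModule (PadicAlgCl p) n K lam) :
    ∃ S : Finset (PadicAlgCl p), (∀ c ∈ S, ‖c‖ ≤ 1) ∧
      ∃ t : ℕ, (((p ^ t : ℕ) : ℤ_[p])) • v ∈ stageLattice K n p lam S := by
  classical
  have hv : v ∈ Submodule.span (PadicAlgCl p) (ResGLnCohomology.coeffIntForm (PadicAlgCl p)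
      (ParallelWeight.stageRing K p ∅) n K lam : Set _) := by
    rw [ResGLnCohomology.span_coeffIntForm_eq_top]
    exact Submodule.mem_top
  obtain ⟨f, F, hF, hfsupp, hsum⟩ := Submodule.mem_span_iff_exists_finset_subset.1 hv
  obtain ⟨t, ht⟩ := ParallelWeight.exists_pow_mul_norm_le_one_finset p (F.image f)
  refine ⟨F.image fun m => ((p : ℕ) : PadicAlgCl p) ^ t * f m, ?_, t, ?_⟩
  · intro c hc
    obtain ⟨m, hm, rfl⟩ := Finset.mem_image.1 hc
    exact ht _ (Finset.mem_image_of_mem f hm)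
  · set S := F.image fun m => ((p : ℕ) : PadicAlgCl p) ^ t * f m with hSdef
    rw [← hsum, Finset.smul_sum]
    refine Submodule.sum_mem _ fun m hm => ?_
    rw [padicInt_smul_def, smul_smul, map_natCast, Nat.cast_pow]
    have hc : ((p : ℕ) : PadicAlgCl p) ^ t * f m ∈ ParallelWeight.stageRing K p S :=
      ParallelWeight.subset_stageRing K p S (Finset.mem_coe.2
        (Finset.mem_image_of_mem (fun m => ((p : ℕ) : PadicAlgCl p) ^ t * f m) hm))
    have hmS : m ∈ ResGLnCohomology.coeffIntForm (PadicAlgCl p) (ParallelWeight.stageRing K p S)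
        n K lam :=
      coeffIntForm_subset (ParallelWeight.stageRing_mono K p (Finset.empty_subset S)) n lam (hF hm)
    have h : (((p : ℕ) : PadicAlgCl p) ^ t * f m) • m =
        (⟨_, hc⟩ : ParallelWeight.stageRing K p S) • m := rfl
    rw [mem_stageLattice_iff, h]
    exact Submodule.smul_mem _ _ hmS

/-! ### Scaling and the congruence condition -/

/-- **If `U'` acts trivially on `M / p^s`, it acts trivially on `p^{-t}M / p^s`.** [folklore] -/
theorem modTrivialOn_divLattice {𝒢grp : Subgroup (BigHeckeGLn.FiniteAdelicGL n K)}
    (M : Submodule ℤ_[p] (ResGLnCohomology.CoeffModule (PadicAlgCl p) n K lam))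
    (hM : ∀ l ∈ 𝒢grp, ∀ m ∈ M, padicIntRep K n p lam l m ∈ M) (s t : ℕ)
    (U' : Subgroup (BigHeckeGLn.FiniteAdelicGL n K))
    (h : TwistedQuotient.ModTrivialOn (padicIntRep K n p lam) M hM (p ^ s) U') :
    TwistedQuotient.ModTrivialOn (padicIntRep K n p lam)
      (TwistedQuotient.divLattice (((p ^ t : ℕ) : ℤ_[p])) M)
      (TwistedQuotient.divLattice_stable 𝒢grp (padicIntRep K n p lam) _ M hM) (p ^ s) U' := by
  intro l hl x
  have hx : (((p ^ t : ℕ) : ℤ_[p])) • (x : ResGLnCohomology.CoeffModule (PadicAlgCl p) n K lam) ∈ M :=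
    x.2
  have h1 := h l hl ⟨_, hx⟩
  rw [TwistedQuotient.mem_nsmulSubmodule_iff] at h1 ⊢
  obtain ⟨y, hy⟩ := h1
  have hy' := congrArg Subtype.val hy
  change (((p ^ s : ℕ) : ℤ_[p])) • (y : ResGLnCohomology.CoeffModule (PadicAlgCl p) n K lam) =
    ResGLnCohomology.padicCoeffRep n K p lam l ((((p ^ t : ℕ) : ℤ_[p])) • (x : _)) -
      (((p ^ t : ℕ) : ℤ_[p])) • (x : _) at hy'
  -- `y' = p^{-t} y`
  have hpt : (((p ^ t : ℕ) : PadicAlgCl p)) ≠ 0 := by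
    exact_mod_cast pow_ne_zero t (Fact.out : p.Prime).ne_zero
  set y' : ResGLnCohomology.CoeffModule (PadicAlgCl p) n K lam :=
    (((p ^ t : ℕ) : PadicAlgCl p))⁻¹ • (y : ResGLnCohomology.CoeffModule (PadicAlgCl p) n K lam)
    with hy'def
  have hpy' : (((p ^ t : ℕ) : ℤ_[p])) • y' = y := by
    rw [hy'def, padicInt_smul_def, smul_smul, map_natCast, mul_inv_cancel₀ hpt, one_smul]
  have hy'mem : y' ∈ TwistedQuotient.divLattice (((p ^ t : ℕ) : ℤ_[p])) M := by
    rw [TwistedQuotient.mem_divLattice_iff, hpy']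
    exact y.2
  refine ⟨⟨y', hy'mem⟩, Subtype.ext ?_⟩
  change (((p ^ s : ℕ) : ℤ_[p])) • y' =
    ResGLnCohomology.padicCoeffRep n K p lam l (x : _) - (x : _)
  apply pow_smul_injective K n p lam t
  change (((p ^ t : ℕ) : ℤ_[p])) • ((((p ^ s : ℕ) : ℤ_[p])) • y') =
    (((p ^ t : ℕ) : ℤ_[p])) • (ResGLnCohomology.padicCoeffRep n K p lam l (x : _) - (x : _))
  rw [smul_comm, hpy', hy', smul_sub, padicInt_smul_def, padicInt_smul_def, map_smul]

end AlgebraicWeight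

end Literature.NumberTheory.Automorphic
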